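import Literature.Analysis.FluidPDE.PassiveScalarDriftApproxL2
import Literature.Analysis.FluidPDE.TimeAvgGradNormMinkowski
import HarnessLib

/-!
# Smooth divergence-free approximation of an `L²` drift with strain control

Analysis/FluidPDE proof-support file (everything proved). The space–time mollification
`vₙ = mollifiedField φ ε U` of DiPerna–Lions 1989, proof of Prop. II.1 (tree:
`exists_smooth_isDivFree_tendsto_eLpNorm_sub_of_sq`), does not increase the time-integrated
`L²` strain: `∫₀ᵀ ‖∇vₙ(t)‖_{L²} dt ≤ ∫₀ᵀ ‖∇u(t)‖_{L²} dt` (spatial mollification contracts every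
Fourier mode, `eGradNormSq_vecMollify_le`; the time average obeys Minkowski's inequality,
`lintegral_eGradNormSq_rpow_half_timeAvgWith_le`). Output:
`exists_smooth_isDivFree_tendsto_eLpNorm_sub_strain`.

## References

* R. J. DiPerna, P.-L. Lions, Invent. Math. 98 (1989), proof of Prop. II.1 and §II.3.
  [`DiPernaLions1989`]
-/

noncomputable section

open _root_.MeasureTheory _root_.TopologicalSpace _root_.Set _root_.Function _root_.Filter _root_.Metric
open _root_.Topology
open scoped ENNReal NNReal Convolution InnerProductSpace ContDiff

namespace Literature.Analysis.FluidPDE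

namespace Torus

variable {d : Type*} [Fintype d]

/-- `eGradNormSq` only depends on the a.e. class of the field (its Fourier coefficients are
integrals). [folklore] -/
theorem eGradNormSq_congr_ae_eq {v w : UnitAddTorus d → EuclideanSpace ℝ d} (h : v =ᵐ[volume] w) :
    FunctionSpaces.Torus.eGradNormSq v = FunctionSpaces.Torus.eGradNormSq w := by
  rw [FunctionSpaces.Torus.eGradNormSq_eq_tsum, FunctionSpaces.Torus.eGradNormSq_eq_tsum]
  congr 1
  refine tsum_congr fun k => ?_
  have e : UnitAddTorus.mFourierCoeff (FunctionSpaces.EuclideanSpace.complexify ∘ v) k =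
      UnitAddTorus.mFourierCoeff (FunctionSpaces.EuclideanSpace.complexify ∘ w) k := by
    rw [FunctionSpaces.Torus.mFourierCoeff_eq_integral_volume, FunctionSpaces.Torus.mFourierCoeff_eq_integral_volume]
    refine integral_congr_ae ?_
    filter_upwards [h] with x hx
    simp only [comp_apply, hx]
  rw [e]

/-- The zero field has no gradient: `eGradNormSq 0 = 0`. [folklore] -/
theorem eGradNormSq_zero_fun : FunctionSpaces.Torus.eGradNormSq (0 : UnitAddTorus d → EuclideanSpace ℝ d) = 0 := by
  rw [FunctionSpaces.Torus.eGradNormSq_eq_tsum]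
  have hc : (⇑(FunctionSpaces.EuclideanSpace.complexify (ι := d)) ∘ (0 : UnitAddTorus d → EuclideanSpace ℝ d)) =
      (0 : UnitAddTorus d → EuclideanSpace ℂ d) := by
    funext x; simp
  have h : ∀ k : d → ℤ, UnitAddTorus.mFourierCoeff (0 : UnitAddTorus d → EuclideanSpace ℂ d) k = 0 := by
    intro k
    rw [FunctionSpaces.Torus.mFourierCoeff_eq_integral_volume]
    simp
  simp [hc, h]

section Drift

variable [DecidableEq d]

/-- **Smooth divergence-free approximation of a square-integrable weakly divergence-free drift,
with strain control** (DiPerna–Lions 1989, proof of Prop. II.1 and §II.3): as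
`exists_smooth_isDivFree_tendsto_eLpNorm_sub_of_sq` (space–time mollification of a strongly
measurable representative of `u 1_{(0,T)}`), with in addition
`∫₀ᵀ ‖∇vₙ‖_{L²} ≤ ∫₀ᵀ ‖∇u‖_{L²}` for every `n` (spectral form). [cite: DiPernaLions1989, Prop. II.1, proof] -/
theorem exists_smooth_isDivFree_tendsto_eLpNorm_sub_strain {T : ℝ} {u : ℝ → UnitAddTorus d → EuclideanSpace ℝ d}
    (hum : AEStronglyMeasurable (FunctionSpaces.Torus.stLift u) (volume.restrict (Ioo 0 T ×ˢ univ)))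
    (hu2 : ∫⁻ t in Ioo 0 T, ∫⁻ x, ‖u t x‖ₑ ^ 2 < ⊤)
    (hdiv : ∀ᵐ t ∂(volume.restrict (Ioo 0 T)), FunctionSpaces.Torus.IsWeaklyDivFree (u t)) :
    ∃ v : ℕ → ℝ → UnitAddTorus d → EuclideanSpace ℝ d,
      (∀ n, ContDiff ℝ ∞ (FunctionSpaces.Torus.stLift (v n))) ∧
      (∀ n t, FunctionSpaces.Torus.IsDivFree (v n t)) ∧
      Tendsto (fun n => eLpNorm (fun q : ℝ × UnitAddTorus d => v n q.1 q.2 - u q.1 q.2) 2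
        (((volume : Measure ℝ).restrict (Ioo 0 T)).prod volume)) atTop (𝓝 0) ∧
      (∀ n, ∫⁻ t in Ioo 0 T, FunctionSpaces.Torus.eGradNormSq (v n t) ^ (1 / 2 : ℝ) ≤
        ∫⁻ t in Ioo 0 T, FunctionSpaces.Torus.eGradNormSq (u t) ^ (1 / 2 : ℝ)) := by
  -- a strongly measurable representative of `u 1_{(0,T)}`
  have hum' : AEStronglyMeasurable (uncurry u) (volume.restrict (Ioo 0 T ×ˢ (univ : Set (UnitAddTorus d)))) :=
    FunctionSpaces.Torus.aestronglyMeasurable_uncurry_of_stLift_restrict hum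
  obtain ⟨U, hUm, hU0, hUae, hUu⟩ := exists_stronglyMeasurable_representative hum'
  have hU2 : MemLp (uncurry U) 2 ((volume : Measure ℝ).prod volume) :=
    memLp_two_representative hUm hU0 hUu hu2
  have hUi : Integrable (uncurry U) ((volume : Measure ℝ).prod volume) := integrable_representative hU0 hU2
  have hUdiv : ∀ᵐ s ∂(volume : Measure ℝ), FunctionSpaces.Torus.IsWeaklyDivFree (U s) :=
    ae_isWeaklyDivFree_representative hU0 hUu hdiv
  -- parameters: time bumps of radius `→ 0`, space radii `εₘ = 1/(4(m+1))`
  obtain ⟨φ, -, hφ⟩ := exists_contDiffBump_seq_rOut one_pos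
  obtain ⟨hpos, hle, hlim⟩ := molRadius_spec
  set ε : ℕ → ℝ := fun m => 1 / (4 * ((m : ℝ) + 1)) with hε
  -- diagonal choice of the time radius
  have hA : ∀ m, ∃ N : ℕ, eLpNorm (fun q : ℝ × UnitAddTorus d =>
      FunctionSpaces.Torus.mollifiedField (φ N) (ε m) U q.1 q.2 - FunctionSpaces.Torus.vecMollify (ε m) (U q.1) q.2) 2
        ((volume : Measure ℝ).prod volume) ≤ ENNReal.ofReal (ε m) := by
    intro m
    have h := tendsto_eLpNorm_mollifiedField_sub hUm hUi hU2 (hpos m) (hle m) hφ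
    obtain ⟨N, hN⟩ := (ENNReal.tendsto_atTop_zero.1 h) (ENNReal.ofReal (ε m)) (ENNReal.ofReal_pos.2 (hpos m))
    exact ⟨N, hN N le_rfl⟩
  choose N hN using hA
  have hAlim : Tendsto (fun m => eLpNorm (fun q : ℝ × UnitAddTorus d =>
      FunctionSpaces.Torus.mollifiedField (φ (N m)) (ε m) U q.1 q.2 - FunctionSpaces.Torus.vecMollify (ε m) (U q.1) q.2) 2
        ((volume : Measure ℝ).prod volume)) atTop (𝓝 0) := by
    have h0 : Tendsto (fun m => ENNReal.ofReal (ε m)) atTop (𝓝 0) := by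
      rw [← ENNReal.ofReal_zero]
      exact ENNReal.tendsto_ofReal hlim
    exact tendsto_of_tendsto_of_tendsto_of_le_of_le tendsto_const_nhds h0 (fun m => zero_le) hN
  have hBlim := tendsto_eLpNorm_vecMollify_uncurry_sub hUm hU2
  -- the approximating fields
  set v : ℕ → ℝ → UnitAddTorus d → EuclideanSpace ℝ d := fun m => FunctionSpaces.Torus.mollifiedField (φ (N m)) (ε m) U
    with hv
  refine ⟨v, fun m => contDiff_stLift_mollifiedField hUi (hpos m) (hle m),
    fun m t => isDivFree_mollifiedField hUi hUdiv (hpos m) (hle m) t, ?_, fun m => ?_⟩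
  swap
  · -- the strain control
    set r : ℝ → ℝ := (φ (N m)).normed volume with hr
    have hrc : Continuous r := (φ (N m)).continuous_normed
    have hrs : HasCompactSupport r := (φ (N m)).hasCompactSupport_normed
    have hr0 : ∀ s, 0 ≤ r s := fun s => (φ (N m)).nonneg_normed s
    have hr1 : ∫ s, r s = 1 := (φ (N m)).integral_normed
    have h1 : ∀ t, FunctionSpaces.Torus.eGradNormSq (v m t) ≤ FunctionSpaces.Torus.eGradNormSq (FunctionSpaces.timeAvgWith r U t) := by
      intro t
      have h := FunctionSpaces.Torus.eGradNormSq_vecMollify_le (FunctionSpaces.Torus.integrable_timeAvgVec hUi hrc hrs t) (hpos m) (hle m)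
      refine h.trans (le_of_eq (eGradNormSq_congr_ae_eq (FunctionSpaces.Torus.timeAvgVec_ae_eq hUi hrc hrs t)))
    calc ∫⁻ t in Ioo 0 T, FunctionSpaces.Torus.eGradNormSq (v m t) ^ (1 / 2 : ℝ)
        ≤ ∫⁻ t in Ioo 0 T, FunctionSpaces.Torus.eGradNormSq (FunctionSpaces.timeAvgWith r U t) ^ (1 / 2 : ℝ) :=
          lintegral_mono fun t => ENNReal.rpow_le_rpow (h1 t) (by norm_num)
      _ ≤ ∫⁻ t, FunctionSpaces.Torus.eGradNormSq (FunctionSpaces.timeAvgWith r U t) ^ (1 / 2 : ℝ) :=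
          lintegral_mono' Measure.restrict_le_self le_rfl
      _ ≤ ∫⁻ s, FunctionSpaces.Torus.eGradNormSq (U s) ^ (1 / 2 : ℝ) :=
          lintegral_eGradNormSq_rpow_half_timeAvgWith_le hUm.aestronglyMeasurable hUi hrc hrs hr0 hr1
      _ = ∫⁻ s in Ioo 0 T, FunctionSpaces.Torus.eGradNormSq (U s) ^ (1 / 2 : ℝ) := by
          rw [← lintegral_add_compl _ measurableSet_Ioo, setLIntegral_congr_fun (measurableSet_Ioo.compl)
            (fun s hs => by rw [hU0 s hs, eGradNormSq_zero_fun, ENNReal.zero_rpow_of_pos (by norm_num)]),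
            lintegral_zero, add_zero]
      _ = ∫⁻ s in Ioo 0 T, FunctionSpaces.Torus.eGradNormSq (u s) ^ (1 / 2 : ℝ) := by
          refine lintegral_congr_ae ?_
          filter_upwards [hUu] with s hs
          rw [eGradNormSq_congr_ae_eq hs]
  -- measurability of the pieces
  have hvm : ∀ m, StronglyMeasurable (uncurry (v m)) := fun m =>
    (continuous_uncurry_mollifiedField hUi (hpos m) (hle m)).stronglyMeasurable
  have hwm : ∀ m, AEStronglyMeasurable (fun q : ℝ × UnitAddTorus d => FunctionSpaces.Torus.vecMollify (ε m) (U q.1) q.2)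
      ((volume : Measure ℝ).prod volume) := by
    intro m
    have h : ∀ i, StronglyMeasurable (uncurry fun s x => ((fun y => U s y i) ⋆ FunctionSpaces.Torus.kernel (ε m)) x) :=
      fun i => stronglyMeasurable_uncurry_convolution (stronglyMeasurable_uncurry_apply hUm i)
        (FunctionSpaces.Torus.continuous_kernel (hpos m) (hle m))
    have h' : (fun q : ℝ × UnitAddTorus d => FunctionSpaces.Torus.vecMollify (ε m) (U q.1) q.2) =
        fun q => WithLp.toLp 2 fun i => (uncurry fun s x => ((fun y => U s y i) ⋆ FunctionSpaces.Torus.kernel (ε m)) x) q := by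
      funext q; rfl
    rw [h']
    exact ((PiLp.continuous_toLp 2 _).measurable.comp
      (measurable_pi_iff.2 fun i => (h i).measurable)).aestronglyMeasurable
  -- `‖v m - u‖_{L²((0,T)×T^d)} = ‖v m - U‖_{L²((0,T)×T^d)} ≤ ‖v m - U‖_{L²(ℝ×T^d)} ≤ ‖v m - u^ε‖ + ‖u^ε - U‖`
  have hμle : ((volume : Measure ℝ).restrict (Ioo 0 T)).prod (volume : Measure (UnitAddTorus d)) ≤
      (volume : Measure ℝ).prod volume := by
    rw [← Measure.restrict_univ (μ := (volume : Measure (UnitAddTorus d))), Measure.prod_restrict,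
      Measure.restrict_univ]
    exact Measure.restrict_le_self
  have hUu' : (fun q : ℝ × UnitAddTorus d => U q.1 q.2) =ᵐ[((volume : Measure ℝ).restrict (Ioo 0 T)).prod volume]
      fun q => u q.1 q.2 := by
    have h1 : uncurry U =ᵐ[volume.restrict (Ioo 0 T ×ˢ (univ : Set (UnitAddTorus d)))]
        (Ioo 0 T ×ˢ univ).indicator (uncurry u) := ae_restrict_of_ae hUae
    have h2 : (Ioo 0 T ×ˢ (univ : Set (UnitAddTorus d))).indicator (uncurry u)
        =ᵐ[volume.restrict (Ioo 0 T ×ˢ (univ : Set (UnitAddTorus d)))] uncurry u :=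
      indicator_ae_eq_restrict (measurableSet_Ioo.prod MeasurableSet.univ)
    have h3 := h1.trans h2
    rw [volume_restrict_prod_eq] at h3
    exact h3
  have hkey : ∀ m, eLpNorm (fun q : ℝ × UnitAddTorus d => v m q.1 q.2 - u q.1 q.2) 2
      (((volume : Measure ℝ).restrict (Ioo 0 T)).prod volume) ≤
      eLpNorm (fun q : ℝ × UnitAddTorus d =>
        FunctionSpaces.Torus.mollifiedField (φ (N m)) (ε m) U q.1 q.2 - FunctionSpaces.Torus.vecMollify (ε m) (U q.1) q.2) 2
        ((volume : Measure ℝ).prod volume) +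
      eLpNorm (fun q : ℝ × UnitAddTorus d =>
        FunctionSpaces.Torus.vecMollify (ε m) (U q.1) q.2 - U q.1 q.2) 2 ((volume : Measure ℝ).prod volume) := by
    intro m
    calc eLpNorm (fun q : ℝ × UnitAddTorus d => v m q.1 q.2 - u q.1 q.2) 2
          (((volume : Measure ℝ).restrict (Ioo 0 T)).prod volume)
        = eLpNorm (fun q : ℝ × UnitAddTorus d => v m q.1 q.2 - U q.1 q.2) 2
          (((volume : Measure ℝ).restrict (Ioo 0 T)).prod volume) := by
          refine eLpNorm_congr_ae ?_
          filter_upwards [hUu'] with q hq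
          rw [hq]
      _ ≤ eLpNorm (fun q : ℝ × UnitAddTorus d => v m q.1 q.2 - U q.1 q.2) 2 ((volume : Measure ℝ).prod volume) :=
          eLpNorm_mono_measure _ hμle
      _ = eLpNorm ((fun q : ℝ × UnitAddTorus d =>
            FunctionSpaces.Torus.mollifiedField (φ (N m)) (ε m) U q.1 q.2 - FunctionSpaces.Torus.vecMollify (ε m) (U q.1) q.2) +
            fun q : ℝ × UnitAddTorus d => FunctionSpaces.Torus.vecMollify (ε m) (U q.1) q.2 - U q.1 q.2) 2
          ((volume : Measure ℝ).prod volume) := by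
          congr 1
          funext q
          simp only [Pi.add_apply, hv, sub_add_sub_cancel]
      _ ≤ _ := eLpNorm_add_le (((hvm m).aestronglyMeasurable.sub (hwm m))) ((hwm m).sub hUm.aestronglyMeasurable) one_le_two
  have hsum : Tendsto (fun m => eLpNorm (fun q : ℝ × UnitAddTorus d =>
        FunctionSpaces.Torus.mollifiedField (φ (N m)) (ε m) U q.1 q.2 - FunctionSpaces.Torus.vecMollify (ε m) (U q.1) q.2) 2
        ((volume : Measure ℝ).prod volume) +
      eLpNorm (fun q : ℝ × UnitAddTorus d =>
        FunctionSpaces.Torus.vecMollify (ε m) (U q.1) q.2 - U q.1 q.2) 2 ((volume : Measure ℝ).prod volume)) atTop (𝓝 0) := by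
    have h := hAlim.add hBlim
    rwa [add_zero] at h
  exact tendsto_of_tendsto_of_tendsto_of_le_of_le tendsto_const_nhds hsum (fun m => zero_le) hkey


end Drift

end Torus

end Literature.Analysis.FluidPDE
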